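import Mathlib
import Literature.Analysis.Convexity.AnisotropicPerimeterPolytopeUnionPatches
import HarnessLib

/-!
# Finite disjoint unions of open polytopes of `ℝ³`, III: the facet-sum formula with internal facets removed

Topic `Literature/Analysis/Convexity`; namespace `Literature.Analysis.Convexity`.
* `pair_contact_sum_eq` — for two cells whose closures meet inside a plane `⟪d.1,·⟫ = d.2`, the
  `h_K`-weighted facet-to-facet contact areas seen from both sides add up to
  `(h_K(d.1) + h_K(-d.1)) ·` (volume of the unit prism over `closure Q_i ∩ closure Q_j`);
* `toReal_anisotropicPerimeter_iUnion_openHPolytope` — **for pairwise disjoint bounded open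
  `H`-polytopes `Q_i` of `EuclideanSpace ℝ (Fin 3)` with separating unit normals `ν i j` and every
  compact convex `K ∋ 0`:
  `P_K(⋃ Q_i) = Σ_i P_K(Q_i) − Σ_{i<j} (h_K(ν_ij) + h_K(−ν_ij)) · |prism over closure Q_i ∩ closure Q_j|`**
  (real-valued; prism volume = facet area), i.e. clause (B) of `PolytopeCalculus`
  (stub_polytopeCalculus of stmt-Ventures-19483, cell `crystal3d-full`; clause (A) is
  `toReal_anisotropicPerimeter_iInter_halfSpace_lt_eq_facetSum`).
[cite: Maggi2012, (20.2) p. 258 and Remark 20.3; EvansGariepy2015, Thm 5.16 (Gauss–Green), polyhedral case]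
-/

noncomputable section

namespace Literature.Analysis.Convexity

open _root_.MeasureTheory Set
open scoped RealInnerProductSpace Topology ENNReal
open Literature.MathematicalPhysics.StatisticalMechanics (fieldDivergence)
open Literature.MeasureTheory.Integral

/-- **The contact contribution of one pair of cells.**  For distinct nonempty cells `i, j` whose
closures meet inside a plane `⟪d.1, ·⟫ = d.2` (`‖d.1‖ = 1`), the `h_K`-weighted contact areas seen from
`i` and from `j` add up to `(h_K(d.1) + h_K(-d.1)) ·` (volume of the unit prism over
`closure Q_i ∩ closure Q_j`): either the contact is null, or exactly one of `d`, `-d` is a facet of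
each cell (with opposite orientations) and the facet-to-facet contact has full area.
[cite: Maggi2012, (20.2) p. 258 and Remark 20.3; EvansGariepy2015, Thm 5.16 (Gauss–Green), polyhedral case] -/
theorem pair_contact_sum_eq {k : ℕ} (H : Fin k → Finset (EuclideanSpace ℝ (Fin 3) × ℝ))
    (Q : Fin k → Set (EuclideanSpace ℝ (Fin 3)))
    (hQ : ∀ i, Q i = ⋂ p ∈ H i, {x : EuclideanSpace ℝ (Fin 3) | ⟪p.1, x⟫ < p.2})
    (J : Fin k → Finset (EuclideanSpace ℝ (Fin 3) × ℝ))
    (hJ : ∀ i, J i = ((H i).filter (fun p => p.1 ≠ 0)).image (fun p => (‖p.1‖⁻¹ • p.1, ‖p.1‖⁻¹ * p.2)))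
    (fU fV : EuclideanSpace ℝ (Fin 3) → EuclideanSpace ℝ (Fin 3))
    (hfr : ∀ a, ‖a‖ = 1 → ‖fU a‖ = 1 ∧ ‖fV a‖ = 1 ∧ ⟪fU a, fV a⟫ = 0 ∧ ⟪a, fU a⟫ = 0 ∧ ⟪a, fV a⟫ = 0)
    (hsym : ∀ a, fU (-a) = fU a ∧ fV (-a) = fV a)
    (Φ : EuclideanSpace ℝ (Fin 3) × ℝ → ℝ × ℝ → EuclideanSpace ℝ (Fin 3))
    (hΦ : ∀ c y, Φ c y = c.2 • c.1 + y.1 • fU c.1 + y.2 • fV c.1)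
    (oF : Fin k → EuclideanSpace ℝ (Fin 3) × ℝ → Set (EuclideanSpace ℝ (Fin 3)))
    (hoF : ∀ i c, oF i c = {x | ⟪c.1, x⟫ = c.2 ∧ ∀ c' ∈ J i, c' ≠ c → ⟪c'.1, x⟫ < c'.2})
    (hbd : ∀ i, Bornology.IsBounded (Q i)) (hdisj : ∀ i j, i ≠ j → Disjoint (Q i) (Q j))
    (K : Set (EuclideanSpace ℝ (Fin 3)))
    {i j : Fin k} (hij : i ≠ j) (hine : (Q i).Nonempty) (hjne : (Q j).Nonempty)
    (d : EuclideanSpace ℝ (Fin 3) × ℝ) (hd1 : ‖d.1‖ = 1)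
    (hR : closure (Q i) ∩ closure (Q j) ⊆ {x | ⟪d.1, x⟫ = d.2}) :
    (∑ c ∈ J i, sSup ((fun y => ⟪y, c.1⟫) '' K) * (volume (Φ c ⁻¹' (oF i c ∩ oF j (-c.1, -c.2)))).toReal) +
      ∑ c ∈ J j, sSup ((fun y => ⟪y, c.1⟫) '' K) * (volume (Φ c ⁻¹' (oF j c ∩ oF i (-c.1, -c.2)))).toReal =
      (sSup ((fun y => ⟪y, d.1⟫) '' K) + sSup ((fun y => ⟪y, -d.1⟫) '' K)) *
        (volume {x : EuclideanSpace ℝ (Fin 3) | ∃ y ∈ closure (Q i) ∩ closure (Q j),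
          ∃ t ∈ Set.Icc (0 : ℝ) 1, x = y + t • d.1}).toReal := by
  classical
  obtain ⟨hQi, h1i, hndi, hcli⟩ := cell_normalForm H Q hQ J hJ hine
  obtain ⟨hQj, h1j, hndj, hclj⟩ := cell_normalForm H Q hQ J hJ hjne
  obtain ⟨hU1, hV1, hUV, haU, haV⟩ := hfr d.1 hd1
  have hΦd : (Φ d) = fun y : ℝ × ℝ => d.2 • d.1 + y.1 • fU d.1 + y.2 • fV d.1 := funext (hΦ d)
  set nd : EuclideanSpace ℝ (Fin 3) × ℝ := (-d.1, -d.2) with hnd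
  have hΦnd : Φ nd = Φ d := chart_neg_eq fU fV hsym Φ hΦ d
  have hdnd : d ≠ nd := by
    intro h
    have h1 : d.1 = -d.1 := congrArg Prod.fst h
    have : d.1 = 0 := by
      have h2 : (2 : ℝ) • d.1 = 0 := by rw [two_smul]; nth_rewrite 2 [h1]; exact add_neg_cancel _
      exact (smul_eq_zero.1 h2).resolve_left two_ne_zero
    rw [this, norm_zero] at hd1; exact zero_ne_one hd1
  -- the contact set in the chart of `d`, its finiteness, and the prism volume
  set ρ : ℝ≥0∞ := volume (Φ d ⁻¹' (closure (Q i) ∩ closure (Q j))) with hρ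
  have hcpt : IsCompact (closure (Q i)) :=
    Metric.isCompact_of_isClosed_isBounded isClosed_closure (hbd i).closure
  have hρfin : ρ ≠ ⊤ := by
    refine (lt_of_le_of_lt (measure_mono (Set.preimage_mono Set.inter_subset_left)) ?_).ne
    rw [hΦd]
    exact (isCompact_chartPreimage d (fU d.1) (fV d.1) hU1 hV1 hUV hcpt).measure_lt_top
  have hprism : volume {x : EuclideanSpace ℝ (Fin 3) | ∃ y ∈ closure (Q i) ∩ closure (Q j),
      ∃ t ∈ Set.Icc (0 : ℝ) 1, x = y + t • d.1} = ρ := by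
    rw [hρ, volume_prism_eq_volume_chartPreimage (p := d.2 • d.1) hd1 hU1 hV1 hUV haU haV
      (fun y hy => by rw [hR hy, inner_smul_right, real_inner_self_eq_norm_sq, hd1]; ring), hΦd]
    rfl
  rw [hprism]
  -- contact sets of non-facet planes are null; the two candidate facets `d`, `-d`
  have hsubR : ∀ c, oF i c ∩ oF j (-c.1, -c.2) ⊆ closure (Q i) ∩ closure (Q j) := by
    intro c
    rw [hoF, hoF, hcli, hclj]
    exact Set.inter_subset_inter (openFacet_subset_closedHPolytope (J i))
      (openFacet_subset_closedHPolytope (J j))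
  have hsubR' : ∀ c, oF j c ∩ oF i (-c.1, -c.2) ⊆ closure (Q i) ∩ closure (Q j) := by
    intro c
    rw [Set.inter_comm (oF j c), hoF, hoF, hcli, hclj]
    exact Set.inter_subset_inter (openFacet_subset_closedHPolytope (J i))
      (openFacet_subset_closedHPolytope (J j))
  have hnull : ∀ c, ‖c.1‖ = 1 → c ≠ d → c ≠ nd → ∀ S ⊆ closure (Q i) ∩ closure (Q j),
      volume (Φ c ⁻¹' S) = 0 := by
    intro c hc1 hcd hcnd S hS
    obtain ⟨hU1c, hV1c, hUVc, haUc, haVc⟩ := hfr c.1 hc1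
    refine measure_mono_null (Set.preimage_mono (hS.trans hR)) ?_
    rw [funext (hΦ c)]
    refine volume_chartPreimage_plane_eq_zero c d (fU c.1) (fV c.1) hc1 hU1c hV1c hUVc haUc haVc ?_
    rintro ⟨μ, hμ1, hμ2⟩
    have hμ : |μ| = 1 := by
      have := congrArg norm hμ1
      rw [norm_smul, hd1, hc1, Real.norm_eq_abs, mul_one] at this
      exact this.symm
    rcases abs_eq (zero_le_one) |>.1 hμ with h | h
    · subst h; rw [one_smul] at hμ1; rw [one_mul] at hμ2
      exact hcd (Prod.ext hμ1.symm hμ2.symm)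
    · subst h; rw [neg_one_smul] at hμ1; rw [neg_one_mul] at hμ2
      apply hcnd
      rw [hnd]; ext <;> simp [hμ1, hμ2]
  -- the two sums reduce to the candidate facets
  set α : ℝ := (volume (Φ d ⁻¹' (oF i d ∩ oF j nd))).toReal with hα
  set α' : ℝ := (volume (Φ d ⁻¹' (oF j d ∩ oF i nd))).toReal with hα'
  have hWi : ∑ c ∈ J i, sSup ((fun y => ⟪y, c.1⟫) '' K) * (volume (Φ c ⁻¹' (oF i c ∩ oF j (-c.1, -c.2)))).toReal =
      (if d ∈ J i then sSup ((fun y => ⟪y, d.1⟫) '' K) * α else 0) +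
        (if nd ∈ J i then sSup ((fun y => ⟪y, -d.1⟫) '' K) * α' else 0) := by
    rw [sum_eq_two_points (J i) _ hdnd (fun c hc hcd hcnd => by
      rw [hnull c (h1i c hc) hcd hcnd _ (hsubR c), ENNReal.toReal_zero, mul_zero])]
    have e1 : nd.1 = -d.1 := by rw [hnd]
    have e2 : ((-nd.1, -nd.2) : EuclideanSpace ℝ (Fin 3) × ℝ) = d := by rw [hnd]; simp
    congr 1
    by_cases h : nd ∈ J i
    · rw [if_pos h, if_pos h, hα', hΦnd, e1, e2, Set.inter_comm]
    · rw [if_neg h, if_neg h]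
  have hWj : ∑ c ∈ J j, sSup ((fun y => ⟪y, c.1⟫) '' K) * (volume (Φ c ⁻¹' (oF j c ∩ oF i (-c.1, -c.2)))).toReal =
      (if d ∈ J j then sSup ((fun y => ⟪y, d.1⟫) '' K) * α' else 0) +
        (if nd ∈ J j then sSup ((fun y => ⟪y, -d.1⟫) '' K) * α else 0) := by
    rw [sum_eq_two_points (J j) _ hdnd (fun c hc hcd hcnd => by
      rw [hnull c (h1j c hc) hcd hcnd _ (hsubR' c), ENNReal.toReal_zero, mul_zero])]
    have e1 : nd.1 = -d.1 := by rw [hnd]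
    have e2 : ((-nd.1, -nd.2) : EuclideanSpace ℝ (Fin 3) × ℝ) = d := by rw [hnd]; simp
    congr 1
    by_cases h : nd ∈ J j
    · rw [if_pos h, if_pos h, hα, hΦnd, e1, e2, Set.inter_comm]
    · rw [if_neg h, if_neg h]
  rw [hWi, hWj]
  -- bounds and structural facts
  have hα_le : α ≤ ρ.toReal := ENNReal.toReal_mono hρfin (measure_mono (Set.preimage_mono (hsubR d)))
  have hα'_le : α' ≤ ρ.toReal :=
    ENNReal.toReal_mono hρfin (measure_mono (Set.preimage_mono (by simpa [hnd] using hsubR' d)))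
  have hα0 : 0 ≤ α := ENNReal.toReal_nonneg
  have hα'0 : 0 ≤ α' := ENNReal.toReal_nonneg
  have hQio : IsOpen (Q i) := by rw [hQ]; exact isOpen_openHPolytope (H i)
  have hQjo : IsOpen (Q j) := by rw [hQ]; exact isOpen_openHPolytope (H j)
  have hQic : Convex ℝ (Q i) := by rw [hQ]; exact convex_openHPolytope (H i)
  have hQjc : Convex ℝ (Q j) := by rw [hQ]; exact convex_openHPolytope (H j)
  have hside : ∀ (l : Fin k) (e : EuclideanSpace ℝ (Fin 3) × ℝ), e ∈ J l →
      (Q l = ⋂ c ∈ J l, {x : EuclideanSpace ℝ (Fin 3) | ⟪c.1, x⟫ < c.2}) → Q l ⊆ {x | ⟪e.1, x⟫ < e.2} := by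
    intro l e he hQl; rw [hQl]; exact Set.biInter_subset_of_mem he
  have E1 : d ∈ J i → d ∈ J j → ρ = 0 := fun hdi hdj => by
    rw [hρ, hΦd]
    exact volume_chartPreimage_contact_eq_zero_of_same_side hQic hQio hQjc hQjo (hdisj i j hij) hine
      hjne d hd1 (fU d.1) (fV d.1) hU1 hV1 hUV haU haV (hside i d hdi hQi) (hside j d hdj hQj)
  have E2 : nd ∈ J i → nd ∈ J j → ρ = 0 := fun hni hnj => by
    rw [hρ, ← hΦnd, funext (hΦ nd)]
    refine volume_chartPreimage_contact_eq_zero_of_same_side hQic hQio hQjc hQjo (hdisj i j hij) hine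
      hjne nd (by rw [hnd]; simpa using hd1) (fU nd.1) (fV nd.1) ?_ ?_ ?_ ?_ ?_
      (hside i nd hni hQi) (hside j nd hnj hQj) <;> simp only [hnd, (hsym d.1).1, (hsym d.1).2,
        inner_neg_left, neg_eq_zero] <;> assumption
  have E3 : ∀ l, (Q l).Nonempty → (Q l = ⋂ c ∈ J l, {x : EuclideanSpace ℝ (Fin 3) | ⟪c.1, x⟫ < c.2}) →
      ¬ (d ∈ J l ∧ nd ∈ J l) := by
    rintro l ⟨x₀, hx₀⟩ hQl ⟨h1, h2⟩
    have a1 : ⟪d.1, x₀⟫ < d.2 := hside l d h1 hQl hx₀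
    have a2 : ⟪nd.1, x₀⟫ < nd.2 := hside l nd h2 hQl hx₀
    simp only [hnd, inner_neg_left] at a2
    linarith
  have F1 : d ∈ J i → nd ∈ J j → α = ρ.toReal := fun hdi hnj => by
    rw [hα, hρ]
    congr 1
    have hnj' : ((-d.1, -d.2) : EuclideanSpace ℝ (Fin 3) × ℝ) ∈ J j := by rw [← hnd]; exact hnj
    have := volume_contact_eq (J i) (J j) h1i h1j hndi hndj (by rw [← hQi]; exact hine)
      (by rw [← hQj]; exact hjne) hdi hnj' (fU d.1) (fV d.1) hU1 hV1 hUV haU haV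
    rw [hΦd, hoF, hoF, hnd, hQi, hQj]
    exact this
  have F2 : d ∈ J j → nd ∈ J i → α' = ρ.toReal := fun hdj hni => by
    rw [hα', hρ]
    congr 1
    have hni' : ((-d.1, -d.2) : EuclideanSpace ℝ (Fin 3) × ℝ) ∈ J i := by rw [← hnd]; exact hni
    have := volume_contact_eq (J j) (J i) h1j h1i hndj hndi (by rw [← hQj]; exact hjne)
      (by rw [← hQi]; exact hine) hdj hni' (fU d.1) (fV d.1) hU1 hV1 hUV haU haV
    rw [hΦd, hoF, hoF, hnd, hQi, hQj, Set.inter_comm (closure _)]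
    exact this
  have G : ρ ≠ 0 → (d ∈ J i ∨ nd ∈ J i) ∧ (d ∈ J j ∨ nd ∈ J j) := fun hρ0 => by
    constructor
    · have := exists_mem_or_neg_mem_of_volume_contact_ne_zero (J i) h1i (by rw [← hQi]; exact hine)
        (B := Q j) (by rw [← hQi]; exact hdisj i j hij) d hd1 (fU d.1) (fV d.1) hU1 hV1 hUV haU haV
        (by rw [← hQi, ← hΦd]; exact hρ0)
      simpa [hnd] using this
    · have := exists_mem_or_neg_mem_of_volume_contact_ne_zero (J j) h1j (by rw [← hQj]; exact hjne)
        (B := Q i) (by rw [← hQj]; exact hdisj j i (Ne.symm hij)) d hd1 (fU d.1) (fV d.1) hU1 hV1 hUV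
        haU haV (by rw [← hQj, ← hΦd, Set.inter_comm]; exact hρ0)
      simpa [hnd] using this
  -- case analysis
  by_cases hρ0 : ρ = 0
  · have hαz : α = 0 := le_antisymm (by rw [hρ0, ENNReal.toReal_zero] at hα_le; exact hα_le) hα0
    have hα'z : α' = 0 := le_antisymm (by rw [hρ0, ENNReal.toReal_zero] at hα'_le; exact hα'_le) hα'0
    simp [hαz, hα'z, hρ0]
  obtain ⟨Gi, Gj⟩ := G hρ0
  have E3i := E3 i hine hQi
  have E3j := E3 j hjne hQj
  rcases Gi with hdi | hni
  · have hdj : d ∉ J j := fun h => hρ0 (E1 hdi h)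
    have hnj : nd ∈ J j := Gj.resolve_left hdj
    have hni : nd ∉ J i := fun h => E3i ⟨hdi, h⟩
    rw [F1 hdi hnj]
    simp [hdi, hdj, hnj, hni]
    ring
  · have hdi : d ∉ J i := fun h => E3i ⟨h, hni⟩
    have hnj : nd ∉ J j := fun h => hρ0 (E2 hni h)
    have hdj : d ∈ J j := Gj.resolve_right hnj
    rw [F2 hdj hni]
    simp [hdi, hdj, hnj, hni]
    ring


/-- **The facet-sum formula for a finite disjoint union of bounded open polytopes of `ℝ³`** (the
anisotropic perimeter is additive up to the internal facets, which cancel with both orientations):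
for pairwise disjoint bounded open `H`-polytopes `Q_i` whose closures meet inside planes with unit
normals `ν i j`, and every compact convex `K ∋ 0`,
`P_K(⋃ Q_i) = Σ_i P_K(Q_i) − Σ_{i<j} (h_K(ν_ij) + h_K(−ν_ij)) · |prism over closure Q_i ∩ closure Q_j|`
(real-valued form; the prism volume is the area of the common facet).
[cite: Maggi2012, (20.2) p. 258 and Remark 20.3; EvansGariepy2015, Thm 5.16 (Gauss–Green), polyhedral case] -/
theorem toReal_anisotropicPerimeter_iUnion_openHPolytope {k : ℕ}
    (H : Fin k → Finset (EuclideanSpace ℝ (Fin 3) × ℝ)) (Q : Fin k → Set (EuclideanSpace ℝ (Fin 3)))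
    (hQ : ∀ i, Q i = ⋂ p ∈ H i, {x : EuclideanSpace ℝ (Fin 3) | ⟪p.1, x⟫ < p.2})
    (ν : Fin k → Fin k → EuclideanSpace ℝ (Fin 3))
    (hbd : ∀ i, Bornology.IsBounded (Q i)) (hdisj : ∀ i j, i ≠ j → Disjoint (Q i) (Q j))
    (hν : ∀ i j, i ≠ j → ‖ν i j‖ = 1 ∧ ∃ b : ℝ,
      closure (Q i) ∩ closure (Q j) ⊆ {x : EuclideanSpace ℝ (Fin 3) | ⟪ν i j, x⟫ = b})
    {K : Set (EuclideanSpace ℝ (Fin 3))} (hKc : IsCompact K) (hK : Convex ℝ K)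
    (hK0 : (0 : EuclideanSpace ℝ (Fin 3)) ∈ K) :
    (anisotropicPerimeter K (⋃ i, Q i)).toReal =
      ∑ i, (anisotropicPerimeter K (Q i)).toReal -
        ∑ i, ∑ j, (if i < j then
          (sSup ((fun y : EuclideanSpace ℝ (Fin 3) => ⟪y, ν i j⟫) '' K) +
              sSup ((fun y : EuclideanSpace ℝ (Fin 3) => ⟪y, -ν i j⟫) '' K)) *
            (volume {x : EuclideanSpace ℝ (Fin 3) | ∃ y ∈ closure (Q i) ∩ closure (Q j),
              ∃ t ∈ Set.Icc (0 : ℝ) 1, x = y + t • ν i j}).toReal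
          else 0) := by
  classical
  -- the data of the union
  set J : Fin k → Finset (EuclideanSpace ℝ (Fin 3) × ℝ) := fun i =>
    ((H i).filter (fun p => p.1 ≠ 0)).image (fun p => (‖p.1‖⁻¹ • p.1, ‖p.1‖⁻¹ * p.2)) with hJdef
  have hJ : ∀ i, J i = ((H i).filter (fun p => p.1 ≠ 0)).image (fun p => (‖p.1‖⁻¹ • p.1, ‖p.1‖⁻¹ * p.2)) :=
    fun i => rfl
  obtain ⟨fU, fV, hfr, hsym⟩ := exists_symmetric_frames
  set Φ : EuclideanSpace ℝ (Fin 3) × ℝ → ℝ × ℝ → EuclideanSpace ℝ (Fin 3) := fun c y =>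
    c.2 • c.1 + y.1 • fU c.1 + y.2 • fV c.1 with hΦdef
  have hΦ : ∀ c y, Φ c y = c.2 • c.1 + y.1 • fU c.1 + y.2 • fV c.1 := fun c y => rfl
  set oF : Fin k → EuclideanSpace ℝ (Fin 3) × ℝ → Set (EuclideanSpace ℝ (Fin 3)) := fun i c =>
    {x | ⟪c.1, x⟫ = c.2 ∧ ∀ c' ∈ J i, c' ≠ c → ⟪c'.1, x⟫ < c'.2} with hoFdef
  have hoF : ∀ i c, oF i c = {x | ⟪c.1, x⟫ = c.2 ∧ ∀ c' ∈ J i, c' ≠ c → ⟪c'.1, x⟫ < c'.2} :=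
    fun i c => rfl
  set I : Finset (Fin k) := Finset.univ.filter (fun i => (Q i).Nonempty) with hIdef
  have hI : ∀ i, i ∈ I ↔ (Q i).Nonempty := fun i => by simp [hIdef]
  set h : EuclideanSpace ℝ (Fin 3) → ℝ := fun a => sSup ((fun y : EuclideanSpace ℝ (Fin 3) => ⟪y, a⟫) '' K)
    with hhdef
  have hpos : ∀ a, 0 ≤ h a := fun a => sSup_inner_nonneg hKc hK0 a
  -- Step A: the patch formula
  have hA := anisotropicPerimeter_iUnion_cells_eq_patchSum H Q hQ J hJ fU fV hfr hsym Φ hΦ oF hoF I hI hbd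
    hdisj hKc hK hK0
  rw [hA, ENNReal.toReal_ofReal (Finset.sum_nonneg fun m _ => mul_nonneg (hpos _) ENNReal.toReal_nonneg),
    Finset.sum_sigma]
  -- Step B: cell by cell, `|D| = |Φ⁻¹ oF| - Σ |Z|`
  have hfin : ∀ i ∈ I, ∀ c ∈ J i, ∀ S ⊆ oF i c, volume (Φ c ⁻¹' S) ≠ ⊤ := by
    intro i hi c hc S hS
    obtain ⟨-, h1i, -, hcli⟩ := cell_normalForm H Q hQ J hJ ((hI i).1 hi)
    obtain ⟨hU1, hV1, hUV, -, -⟩ := hfr c.1 (h1i c hc)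
    have hcpt : IsCompact (closure (Q i)) :=
      Metric.isCompact_of_isClosed_isBounded isClosed_closure (hbd i).closure
    have hsub : Φ c ⁻¹' S ⊆ Φ c ⁻¹' closure (Q i) := by
      refine Set.preimage_mono (hS.trans ?_)
      rw [hoF, hcli]; exact openFacet_subset_closedHPolytope (J i)
    refine (lt_of_le_of_lt (measure_mono hsub) ?_).ne
    exact (isCompact_chartPreimage c (fU c.1) (fV c.1) hU1 hV1 hUV hcpt).measure_lt_top
  have hB : ∀ i ∈ I, ∀ c ∈ J i,
      (volume (Φ c ⁻¹' (oF i c \ ⋃ j ∈ I.erase i, closure (Q j)))).toReal =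
        (volume (Φ c ⁻¹' oF i c)).toReal -
          ∑ j ∈ I.erase i, (volume (Φ c ⁻¹' (oF i c ∩ oF j (-c.1, -c.2)))).toReal := by
    intro i hi c hc
    rw [volume_openFacet_split H Q hQ J hJ fU fV hfr Φ hΦ oF hoF I hI hdisj hi hc,
      ENNReal.toReal_add (hfin i hi c hc _ Set.sdiff_subset)
        (ENNReal.sum_ne_top.2 fun j _ => hfin i hi c hc _ Set.inter_subset_left),
      ENNReal.toReal_sum fun j _ => hfin i hi c hc _ Set.inter_subset_left]
    ring
  -- Step C: the cell perimeters
  have hC : ∀ i ∈ I, ∑ c ∈ J i, h c.1 * (volume (Φ c ⁻¹' oF i c)).toReal =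
      (anisotropicPerimeter K (Q i)).toReal := by
    intro i hi
    obtain ⟨hQi, h1i, hndi, -⟩ := cell_normalForm H Q hQ J hJ ((hI i).1 hi)
    have hne' : (⋂ c ∈ J i, {x : EuclideanSpace ℝ (Fin 3) | ⟪c.1, x⟫ < c.2}).Nonempty := by
      rw [← hQi]; exact (hI i).1 hi
    have hbd' : Bornology.IsBounded (⋂ c ∈ J i, {x : EuclideanSpace ℝ (Fin 3) | ⟪c.1, x⟫ < c.2}) := by
      rw [← hQi]; exact hbd i
    rw [hQi, anisotropicPerimeter_openHPolytope_eq_facetSum (J i) h1i hndi hne' hbd'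
      (fun c => fU c.1) (fun c => fV c.1) (fun c hc => (hfr c.1 (h1i c hc)).1)
      (fun c hc => (hfr c.1 (h1i c hc)).2.1) (fun c hc => (hfr c.1 (h1i c hc)).2.2.1)
      (fun c hc => (hfr c.1 (h1i c hc)).2.2.2.1) (fun c hc => (hfr c.1 (h1i c hc)).2.2.2.2) hKc hK hK0,
      ENNReal.toReal_ofReal (Finset.sum_nonneg fun c _ => mul_nonneg (hpos _) ENNReal.toReal_nonneg)]
  have hC' : ∑ i, (anisotropicPerimeter K (Q i)).toReal =
      ∑ i ∈ I, ∑ c ∈ J i, h c.1 * (volume (Φ c ⁻¹' oF i c)).toReal := by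
    rw [← Finset.sum_subset (Finset.subset_univ I) (fun i _ hi => by
      have hQe : Q i = ∅ := Set.not_nonempty_iff_eq_empty.1 (fun hne => hi ((hI i).2 hne))
      rw [hQe, anisotropicPerimeter_of_volume_eq_zero (by simp), ENNReal.toReal_zero])]
    exact Finset.sum_congr rfl fun i hi => (hC i hi).symm
  -- Step D: the contact terms, pair by pair
  have hD : ∑ i ∈ I, ∑ c ∈ J i, ∑ j ∈ I.erase i, h c.1 * (volume (Φ c ⁻¹' (oF i c ∩ oF j (-c.1, -c.2)))).toReal =
      ∑ i, ∑ j, (if i < j then (h (ν i j) + h (-ν i j)) *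
        (volume {x : EuclideanSpace ℝ (Fin 3) | ∃ y ∈ closure (Q i) ∩ closure (Q j),
          ∃ t ∈ Set.Icc (0 : ℝ) 1, x = y + t • ν i j}).toReal else 0) := by
    have hswap : ∀ i ∈ I, ∑ c ∈ J i, ∑ j ∈ I.erase i,
        h c.1 * (volume (Φ c ⁻¹' (oF i c ∩ oF j (-c.1, -c.2)))).toReal =
        ∑ j ∈ I.erase i, ∑ c ∈ J i, h c.1 * (volume (Φ c ⁻¹' (oF i c ∩ oF j (-c.1, -c.2)))).toReal :=
      fun i _ => Finset.sum_comm
    rw [Finset.sum_congr rfl hswap, sum_sum_erase_eq_sum_sum_lt I]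
    -- pair identity on `I × I`, zero outside
    have hpair : ∀ i ∈ I, ∀ j ∈ I, (if i < j then
        (∑ c ∈ J i, h c.1 * (volume (Φ c ⁻¹' (oF i c ∩ oF j (-c.1, -c.2)))).toReal) +
          ∑ c ∈ J j, h c.1 * (volume (Φ c ⁻¹' (oF j c ∩ oF i (-c.1, -c.2)))).toReal else 0) =
        (if i < j then (h (ν i j) + h (-ν i j)) *
          (volume {x : EuclideanSpace ℝ (Fin 3) | ∃ y ∈ closure (Q i) ∩ closure (Q j),
            ∃ t ∈ Set.Icc (0 : ℝ) 1, x = y + t • ν i j}).toReal else 0) := by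
      intro i hi j hj
      split_ifs with hlt
      · obtain ⟨hν1, b, hb⟩ := hν i j hlt.ne
        exact pair_contact_sum_eq H Q hQ J hJ fU fV hfr hsym Φ hΦ oF hoF hbd hdisj K hlt.ne
          ((hI i).1 hi) ((hI j).1 hj) (ν i j, b) hν1 hb
      · rfl
    rw [Finset.sum_congr rfl fun i hi => Finset.sum_congr rfl fun j hj => hpair i hi j hj]
    -- extend the double sum to all indices (empty cells contribute nothing)
    have hzero : ∀ i j, ¬ (i ∈ I ∧ j ∈ I) → (if i < j then (h (ν i j) + h (-ν i j)) *
        (volume {x : EuclideanSpace ℝ (Fin 3) | ∃ y ∈ closure (Q i) ∩ closure (Q j),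
          ∃ t ∈ Set.Icc (0 : ℝ) 1, x = y + t • ν i j}).toReal else 0) = 0 := by
      intro i j hnot
      split_ifs with hlt
      · have hempty : closure (Q i) ∩ closure (Q j) = ∅ := by
          rcases not_and_or.1 hnot with h' | h'
          · have : Q i = ∅ := Set.not_nonempty_iff_eq_empty.1 (fun hne => h' ((hI i).2 hne))
            rw [this, closure_empty, Set.empty_inter]
          · have : Q j = ∅ := Set.not_nonempty_iff_eq_empty.1 (fun hne => h' ((hI j).2 hne))
            rw [this, closure_empty, Set.inter_empty]
        rw [hempty]
        simp
      · rfl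
    symm
    rw [← Finset.sum_subset (Finset.subset_univ I) (fun i _ hi => Finset.sum_eq_zero fun j _ =>
      hzero i j (fun h' => hi h'.1))]
    refine Finset.sum_congr rfl fun i hi => ?_
    rw [← Finset.sum_subset (Finset.subset_univ I) (fun j _ hj => hzero i j (fun h' => hj h'.2))]
  -- Step E: assemble
  rw [hC', ← hD]
  have hsplit : ∀ i ∈ I, ∑ c ∈ J i, h c.1 *
      (volume (Φ c ⁻¹' (oF i c \ ⋃ j ∈ I.erase i, closure (Q j)))).toReal =
      ∑ c ∈ J i, h c.1 * (volume (Φ c ⁻¹' oF i c)).toReal -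
        ∑ c ∈ J i, ∑ j ∈ I.erase i, h c.1 * (volume (Φ c ⁻¹' (oF i c ∩ oF j (-c.1, -c.2)))).toReal := by
    intro i hi
    rw [← Finset.sum_sub_distrib]
    refine Finset.sum_congr rfl fun c hc => ?_
    rw [hB i hi c hc, mul_sub, Finset.mul_sum]
  rw [Finset.sum_congr rfl hsplit, Finset.sum_sub_distrib]


end Literature.Analysis.Convexity

end
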